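import Summits.HodgeConjecture.HodgeConjecture.Theorems.PadicSemiregularLiftHodgeFermatVarietiesSigmaStdOfFibre
import Summits.HodgeConjecture.HodgeConjecture.Theorems.PadicSemiregularLiftHodgeFermatVarietiesReachStd
import HarnessLib

/-!
# Stripping a `p₁`-fibre: a Hodge multiset is reachable RELATIVE to a shorter one — stub GS-step `stub_relReach_shorter` of line `cancel-by-any-claim-lattice`, crux `HodgeFermatVarieties` (stmt-HodgeConjecture-1334)

Crux `HodgeFermatVarieties` (stmt-HodgeConjecture-1334), line `cancel-by-any-claim-lattice`, stub GS-step
`stub_relReach_shorter` (worker file). Everything here is PROVED (no `sorry`, no new definition, no new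
named fact); it reuses the bookkeeping of `…SigmaFiveOfFibre` / `…SigmaStdOfFibre` (extraction of the
`p - 1` progression points, `isHodgeMultiset_add_map_neg`, `sum_map_pair`) and the side-condition lemma
`CoprimeSix.two_lt_div_gcd_of_progression_ne_zero_of_dvd` of `…ReachCoprimeThirty`.

The lead's programme GS proves, at a level `m` coprime to `6` with one small prime `p₁ ≥ 5`, that every
Hodge multiset is ℤ-reachable from the printed supply, by induction on the length: a non-paired Hodge
multiset `s` contains all but one (`j₀`) of the `p₁` points `A + j e`, `e = m/p₁`, of a progression with
`p₁ A ≠ 0` (stub GS-L2), and THIS file is the induction step "strip the fibre":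

* `map_neg_range_map_progression`: the negative of a full `p`-progression `{A + i e : i < p}` (`p e = 0`, no
  repetition) is the full progression `{-A + i e : i < p}` (reindex `i ↦ (p - i) mod p`).
* `exists_shorter_of_fibre` (abstract form, any `p`, any `e` with `p e = 0`): with `F` the `p - 1`
  progression points in `s`, `s = F + u`, and `σ⁻ := {-A + i e : i < p} + {-(p · (-A))}` (Aoki's standard
  element at `-A`, assumed Hodge), one has `s + σ⁻ = t + Σ_{x ∈ F} {x, -x}` with
  `t := u + {-(A + j₀ e), p A}`, a Hodge multiset (`IsHodgeMultiset.of_add_left` by the Hodge sum of pairs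
  `F + (-F)`) with `#t + (p - 1) = #s + 2`.
* `stub_relReach_shorter` (registered signature): `P :=` the pairs `{x, -x}`, `x ∈ F` (first supply
  component, `x ≠ 0` as `s` is zero-free), `N := {σ⁻}` — `σ⁻` is Hodge by `isHodgeMultiset_pStandard` at
  `a = -A` (`p₁ = 2r + 1`, `p₁ (-A) ≠ 0`) and lies in the FOURTH supply component with `p = p₁`, `a = -A`:
  the progression of `-A` is zero-free (`-A + i e = 0` would give `p₁ A = i · p₁ e = 0`), so Aoki's side
  condition `2 < (m/p₁)/(⟨-A⟩, m/p₁)` is `two_lt_div_gcd_of_progression_ne_zero_of_dvd`.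

What is NOT here: the level analysis producing the fibre (stubs GS-L2a/GS-L2, the lead's files) and the
induction itself (GS-main, derived in the line's skeleton).

References: [Aoki1987] N. Aoki, Some new algebraic cycles on Fermat varieties, J. Math. Soc. Japan 39
(1987) 385–396, Thm. 1-1, Thm. 1-2 (p. 387), Thm. 2-1 (p. 388); [Aoki1983] N. Aoki, Math. Ann. 266 (1983)
§5 Prop. 5.1; [Shioda1979PJA] T. Shioda, Proc. Japan Acad. 55A (1979) §1.
-/

-- D-0017: single-problem summit, `Summit.HodgeConjecture.HodgeConjecture.…` repeats the component by design.
set_option linter.dupNamespace false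

noncomputable section

open Finset
open Literature.AlgebraicGeometry.HodgeTheory Literature.AlgebraicGeometry.HodgeTheory.FermatCharacter

namespace Summit.HodgeConjecture.HodgeConjecture.Theorems.CancelByAnyClaimLattice.CoprimeSix

/-- `Supply[M]` — the printed supply of level `M` (local notation of the line, verbatim). -/
local notation3 (prettyPrint := false) "Supply[" M "]" =>
  ({s : Multiset (ZMod M) | ∃ a : ZMod M, a ≠ 0 ∧ s = ({a, -a} : Multiset (ZMod M))} ∪
    {s : Multiset (ZMod M) | IsHodgeMultiset s ∧ Multiset.card s = 4} ∪
    {s : Multiset (ZMod M) | IsHodgeMultiset s ∧ IsSemiDecomposable s} ∪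
    {s : Multiset (ZMod M) | ∃ (p : ℕ) (a : ZMod M), p.Prime ∧ p ≠ 2 ∧ p ∣ M ∧
        2 < (M / p) / Nat.gcd (ZMod.val a) (M / p) ∧
        s = Multiset.map (fun j : ℕ => a + (j : ZMod M) * ((M / p : ℕ) : ZMod M)) (Multiset.range p) +
              {-((p : ZMod M) * a)}} : Set (Multiset (ZMod M)))

/-- `Reach[M, s]` (local notation of the line, verbatim). -/
local notation3 (prettyPrint := false) "Reach[" M ", " s "]" =>
  ∃ P N : Multiset (Multiset (ZMod M)),
    (∀ u ∈ P, u ∈ Supply[M]) ∧ (∀ u ∈ N, u ∈ Supply[M]) ∧ s + Multiset.sum N = Multiset.sum P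

/-! ### The negative of a full progression -/

/-- **The negative of a full `p`-progression is the full progression at `-A`.** If `p e = 0` and the
progression `{A + i e : i < p}` of `ℤ/m` has no repetition, then `{-(A + i e) : i < p} = {-A + i e : i < p}`:
`-(A + j e) = -A + ((p - j) mod p) e`, so the left side (again without repetition) is contained in the
right side, and both have `p` elements. [folklore] -/
theorem map_neg_range_map_progression {m p : ℕ} {A e : ZMod m} (hpe : (p : ZMod m) * e = 0)
    (hnd : ((Multiset.range p).map (fun i : ℕ ↦ A + (i : ZMod m) * e)).Nodup) :
    ((Multiset.range p).map (fun i : ℕ ↦ A + (i : ZMod m) * e)).map (fun a ↦ -a) =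
      (Multiset.range p).map (fun i : ℕ ↦ -A + (i : ZMod m) * e) := by
  refine Multiset.eq_of_le_of_card_le
    ((Multiset.le_iff_subset (hnd.map neg_injective)).mpr fun x hx ↦ ?_) (by simp)
  obtain ⟨y, hy, rfl⟩ := Multiset.mem_map.mp hx
  obtain ⟨j, hj, rfl⟩ := Multiset.mem_map.mp hy
  rw [Multiset.mem_range] at hj
  refine Multiset.mem_map.mpr ⟨(p - j) % p, Multiset.mem_range.mpr (Nat.mod_lt _ (by omega)), ?_⟩
  have h1 : (p - j) % p + p * ((p - j) / p) = p - j := Nat.mod_add_div _ _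
  have h2 : (((p - j) % p : ℕ) : ZMod m) =
      (p : ZMod m) - (j : ZMod m) - (p : ZMod m) * (((p - j) / p : ℕ) : ZMod m) := by
    have h := congrArg (Nat.cast : ℕ → ZMod m) h1
    rw [Nat.cast_add, Nat.cast_mul, Nat.cast_sub hj.le] at h
    linear_combination h
  rw [h2]
  linear_combination (1 - (((p - j) / p : ℕ) : ZMod m)) * hpe

/-! ### The core: stripping the fibre, abstract form -/

/-- **Stripping a `p`-fibre, abstract form.** Let `s` be a Hodge multiset of level `m`, `A, e ∈ ℤ/m` with
`p e = 0`, the progression `{A + i e : i < p}` without repetition, and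
`σ⁻ = {-A + i e : i < p} + {-(p · (-A))}` (Aoki's standard element at `-A`) a Hodge multiset. If
`A + j e ∈ s` for all `j < p`, `j ≠ j₀`, then there are a Hodge multiset `t` with `#t + (p - 1) = #s + 2`
and a zero-free `F` with `s + σ⁻ = t + Σ_{x ∈ F} {x, -x}`: `F :=` the `p - 1` progression points in `s`,
`s = F + u`, `t := u + {-(A + j₀ e), pA}`; indeed `σ⁻ = (-F) + {-(A + j₀ e)} + {pA}`
(`map_neg_range_map_progression`), `Σ_{x ∈ F} {x, -x} = F + (-F)` is Hodge (pairs), and `t` is Hodge by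
cancellation (`IsHodgeMultiset.of_add_left`). [cite: Aoki1987, Thm. 1-2 (p. 387) and Thm. 2-1] -/
theorem exists_shorter_of_fibre {m : ℕ} [NeZero m] {p : ℕ} {s : Multiset (ZMod m)} (hs : IsHodgeMultiset s)
    {A e : ZMod m} (hpe : (p : ZMod m) * e = 0)
    (hσ : IsHodgeMultiset ((Multiset.range p).map (fun i : ℕ ↦ -A + (i : ZMod m) * e) +
      {-((p : ZMod m) * -A)}))
    (hnd : ((Multiset.range p).map (fun i : ℕ ↦ A + (i : ZMod m) * e)).Nodup)
    {j₀ : ℕ} (hj₀ : j₀ < p) (hfib : ∀ j : ℕ, j < p → j ≠ j₀ → A + (j : ZMod m) * e ∈ s) :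
    ∃ t : Multiset (ZMod m), IsHodgeMultiset t ∧ Multiset.card t + (p - 1) = Multiset.card s + 2 ∧
      ∃ F : Multiset (ZMod m), (∀ x ∈ F, x ≠ 0) ∧
        s + ((Multiset.range p).map (fun i : ℕ ↦ -A + (i : ZMod m) * e) + {-((p : ZMod m) * -A)}) =
          t + (F.map fun x ↦ ({x, -x} : Multiset (ZMod m))).sum := by
  -- adapted from `eq_sigmaStd_of_fibre` (…SigmaStdOfFibre): the extraction `s = F + u`
  classical
  have hneg := map_neg_range_map_progression hpe hnd
  set f : ℕ → ZMod m := fun i ↦ A + (i : ZMod m) * e with hf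
  -- the `p - 1` progression points lying in `s`
  set F : Multiset (ZMod m) := ((Finset.range p).erase j₀).val.map f with hF
  have hsplit : (Multiset.range p).map f = f j₀ ::ₘ F := by
    rw [hF, ← Multiset.map_cons f j₀, ← Finset.insert_val_of_notMem (Finset.notMem_erase j₀ _),
      Finset.insert_erase (Finset.mem_range.mpr hj₀), Finset.range_val]
  have hFnd : F.Nodup := by
    refine Multiset.nodup_of_le ?_ hnd
    rw [hsplit]
    exact Multiset.le_cons_self _ _
  have hFs : F ≤ s := by
    refine (Multiset.le_iff_subset hFnd).mpr fun x hx ↦ ?_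
    obtain ⟨j, hj, rfl⟩ := Multiset.mem_map.mp hx
    rw [Finset.mem_val, Finset.mem_erase, Finset.mem_range] at hj
    exact hfib j hj.2 hj.1
  obtain ⟨u, hsu⟩ := Multiset.le_iff_exists_add.mp hFs
  have hFcard : Multiset.card F = p - 1 := by
    rw [hF, Multiset.card_map, Finset.card_val, Finset.card_erase_of_mem (Finset.mem_range.mpr hj₀),
      Finset.card_range]
  -- the pairs `{x, -x}`, `x ∈ F`, form a Hodge multiset
  have hF0 : ∀ x ∈ F, x ≠ 0 := fun x hx ↦ hs.1.1 x (Multiset.mem_of_le hFs hx)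
  have hpairs : IsHodgeMultiset (F + F.map (fun a ↦ -a)) := isHodgeMultiset_add_map_neg hF0
  -- the key multiset identity `s + σ⁻ = (F + (-F)) + t`
  have heq : s + ((Multiset.range p).map (fun i : ℕ ↦ -A + (i : ZMod m) * e) + {-((p : ZMod m) * -A)}) =
      (F + F.map (fun a ↦ -a)) + (u + {-(f j₀), (p : ZMod m) * A}) := by
    rw [← hneg, hsu, hsplit]
    simp only [Multiset.map_add, Multiset.map_singleton, mul_neg, neg_neg, Multiset.insert_eq_cons,
      ← Multiset.singleton_add]
    abel
  refine ⟨u + {-(f j₀), (p : ZMod m) * A}, ?_, ?_, F, hF0, ?_⟩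
  · -- `t` is Hodge: cancel the pairs from the Hodge multiset `s + σ⁻`
    have hbig := hs.add hσ
    rw [heq] at hbig
    exact hbig.of_add_left hpairs
  · -- `#t + (p - 1) = #s + 2`
    have hc := congrArg Multiset.card hsu
    rw [Multiset.card_add, hFcard] at hc
    rw [Multiset.card_add, Multiset.card_pair, hc]
    omega
  · rw [heq, sum_map_pair, add_comm]

/-! ### The registered stub -/

/-- **GS-step `stub_relReach_shorter` — stripping the fibre: `s` is reachable RELATIVE to a shorter Hodge
multiset.** For a prime `p₁ ≥ 5`, a level `m` coprime to `6` with `p₁ ∣ m`, a Hodge multiset `s`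
containing all but one (`j₀`) of the `p₁` points `A + j(m/p₁)` (`p₁A ≠ 0`): there are a Hodge multiset `t`
with `#t + (p₁ - 1) = #s + 2` and finite families `P, N` of supply elements with `s + ΣN = t + ΣP`. Take
`N := {σ⁻}`, `σ⁻ := {-A + j(m/p₁) : j < p₁} + {-(p₁ · (-A))}` — a Hodge multiset
(`isHodgeMultiset_pStandard` at `-A`, `p₁ = 2r + 1`) lying in the fourth supply component with `p = p₁`,
`a = -A` (the progression of `-A` is zero-free since `-A + j(m/p₁) = 0` forces `p₁A = 0`, whence Aoki's
side condition by `two_lt_div_gcd_of_progression_ne_zero_of_dvd`) — and `P :=` the pairs `{x, -x}` over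
the `p₁ - 1` progression points `x ∈ s` (first supply component); `t := (s ∖ F) + {-(A + j₀(m/p₁)), p₁A}`
by `exists_shorter_of_fibre`. [cite: Aoki1987, Thm. 1-2 (p. 387) and Thm. 2-1] -/
theorem stub_relReach_shorter : ∀ (p₁ : ℕ), p₁.Prime → 5 ≤ p₁ → ∀ (m : ℕ) [NeZero m], m.Coprime 6 → p₁ ∣ m → ∀ s : Multiset (ZMod m), IsHodgeMultiset s → ∀ A : ZMod m, (p₁ : ZMod m) * A ≠ 0 → (∃ j₀ : ℕ, j₀ < p₁ ∧ ∀ j : ℕ, j < p₁ → j ≠ j₀ → A + (j : ZMod m) * ((m / p₁ : ℕ) : ZMod m) ∈ s) → ∃ t : Multiset (ZMod m), IsHodgeMultiset t ∧ Multiset.card t + (p₁ - 1) = Multiset.card s + 2 ∧ ∃ P N : Multiset (Multiset (ZMod m)), (∀ u ∈ P, u ∈ Supply[m]) ∧ (∀ u ∈ N, u ∈ Supply[m]) ∧ s + Multiset.sum N = t + Multiset.sum P := by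
  intro p₁ hp₁ hp5 m _ hm hpm s hs A hA hfib
  obtain ⟨j₀, hj₀, hfib⟩ := hfib
  -- `p₁ · (m/p₁) = 0`, `p₁ (-A) ≠ 0`, `p₁ = 2r + 1`
  have he : (p₁ : ZMod m) * ((m / p₁ : ℕ) : ZMod m) = 0 := by
    rw [← Nat.cast_mul, Nat.mul_div_cancel' hpm, ZMod.natCast_self]
  have hA' : (p₁ : ZMod m) * -A ≠ 0 := by rwa [mul_neg, neg_ne_zero]
  obtain ⟨r, hr⟩ := hp₁.odd_of_ne_two (by omega)
  -- Aoki's standard element at `-A` is Hodge; the progression of `A` has no repetition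
  have hσ : IsHodgeMultiset ((Multiset.range p₁).map
      (fun i : ℕ ↦ -A + (i : ZMod m) * ((m / p₁ : ℕ) : ZMod m)) + {-((p₁ : ZMod m) * -A)}) :=
    isHodgeMultiset_pStandard hr hpm hA'
  have hnd : ((Multiset.range p₁).map (fun i : ℕ ↦ A + (i : ZMod m) * ((m / p₁ : ℕ) : ZMod m))).Nodup := by
    rw [range_map_eq_filter_of_dvd_one hpm A]
    exact Finset.nodup _
  -- the progression of `-A` is zero-free (Aoki's side condition)
  have hA0 : ∀ j : ℕ, j < p₁ → -A + (j : ZMod m) * ((m / p₁ : ℕ) : ZMod m) ≠ 0 := fun j _ h ↦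
    hA (by linear_combination (-(p₁ : ZMod m)) * h + (j : ZMod m) * he)
  obtain ⟨t, ht, hcard, F, hF0, heq⟩ := exists_shorter_of_fibre hs he hσ hnd hj₀ hfib
  refine ⟨t, ht, hcard, F.map fun x ↦ ({x, -x} : Multiset (ZMod m)),
    {(Multiset.range p₁).map (fun i : ℕ ↦ -A + (i : ZMod m) * ((m / p₁ : ℕ) : ZMod m)) +
      {-((p₁ : ZMod m) * -A)}},
    fun u hu ↦ ?_, fun u hu ↦ ?_, ?_⟩
  · -- the pairs: first supply component
    obtain ⟨x, hx, rfl⟩ := Multiset.mem_map.1 hu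
    exact Or.inl (Or.inl (Or.inl ⟨x, hF0 x hx, rfl⟩))
  · -- `σ⁻`: fourth supply component with `p = p₁`, `a = -A`
    rw [Multiset.mem_singleton] at hu
    rw [hu]
    exact Or.inr ⟨p₁, -A, hp₁, by omega, hpm,
      two_lt_div_gcd_of_progression_ne_zero_of_dvd hm hp₁.pos hpm hA0, rfl⟩
  · rw [Multiset.sum_singleton]
    exact heq

end Summit.HodgeConjecture.HodgeConjecture.Theorems.CancelByAnyClaimLattice.CoprimeSix

end
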